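import Mathlib.RingTheory.MvPowerSeries.Basic
import Mathlib.RingTheory.MvPowerSeries.Inverse
import Mathlib.RingTheory.MvPowerSeries.Order
import Mathlib.RingTheory.MvPowerSeries.PiTopology
import Mathlib.RingTheory.MvPowerSeries.Substitution
import Mathlib.Analysis.Normed.Field.Basic
import Mathlib.Analysis.Normed.Group.InfiniteSum
import Mathlib.Analysis.Normed.Ring.InfiniteSum
import Mathlib.Analysis.Normed.Group.FunctionSeries
import Mathlib.Topology.Algebra.InfiniteSum.ENNReal
import Mathlib.Topology.Algebra.InfiniteSum.Ring
import Mathlib.Analysis.SpecificLimits.Basic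
import HarnessLib

/-!
# Convergent power series: weighted `ℓ¹`-norms on `MvPowerSeries σ 𝕜`

Topic `Literature/RingTheory/MvPowerSeries`.  The ring `𝕜{x}` of convergent power series over a
complete normed field (`ℝ{x}`, `ℂ{x}`), set up through the family of **weighted `ℓ¹`-norms**
`‖f‖_ρ = ∑_α ‖f_α‖ ρ^α ∈ [0, ∞]` (`wnorm ρ f`, one for each polyradius `ρ : σ → ℝ≥0`), the
pseudo-Banach algebras `B_ρ = {f | ‖f‖_ρ < ∞}` of H. Grauert, R. Remmert, *Analytische
Stellenalgebren*, Springer 1971, Kap. I, §§1–3 (also: J. M. Ruiz, *The basic theory of power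
series*, Vieweg 1993, §§1–3; C. de Jong, G. Pfister, *Local analytic geometry*, Vieweg 2000,
§3.1).  A power series is *convergent* when some `‖f‖_ρ` with all `ρᵢ > 0` is finite.

Everything here is proved (no named facts):

* `wt ρ α = ρ^α`, `wnorm ρ f = ∑' α, ‖coeff α f‖₊ · ρ^α` (in `ℝ≥0∞`); `wnorm` is a seminorm,
  monotone in `ρ`, **submultiplicative** (`wnorm_mul_le`), exact on monomials, and dominates every
  coefficient (`coeff_mul_wt_le_wnorm`); countable subadditivity for sums converging
  coefficientwise (`wnorm_tsum_le`).
* Shrinking the polyradius kills series without constant term linearly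
  (`wnorm_smul_le_of_constantCoeff_eq_zero`: `‖f‖_{cρ} ≤ c ‖f‖_ρ` for `c ≤ 1`, `f(0) = 0`).
* `HasPosRadius f` and the subalgebra `convergent σ 𝕜` of convergent power series; **units**:
  a convergent series with non-zero constant coefficient has a convergent inverse
  (`wnorm_inv_lt_top`, `HasPosRadius.inv`), so `convergent σ 𝕜` is a local ring in the sense
  that its non-units are exactly the series vanishing at `0` (`isUnit_iff_constantCoeff_ne_zero`).
* `rescale` and **substitution** bounds: `‖f(a)‖_ρ ≤ ‖f‖_{ρ'}` whenever `‖aᵢ‖_ρ ≤ ρ'ᵢ` and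
  `aᵢ(0) = 0` (`wnorm_subst_le`), hence substitution preserves convergence
  (`HasPosRadius.subst`).
* **Evaluation** `eval f x = ∑' α, coeff α f · x^α` on the closed polydisc `‖xᵢ‖ ≤ ρᵢ` when
  `‖f‖_ρ < ∞`: absolutely convergent, bounded by `‖f‖_ρ`, additive and multiplicative
  (`eval_mul`, Cauchy product), `eval f 0 = f(0)`, continuous on the polydisc (`continuousOn_eval`).

This is the first file of the tree's route to the Weierstrass preparation theorem for convergent
power series and to the Denef–van den Dries quantifier elimination for the real field with
restricted analytic functions (o-minimality of `ℝ_an`).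

## References

* H. Grauert, R. Remmert, *Analytische Stellenalgebren*, Grundlehren 176, Springer (1971),
  Kap. I §1–§3. [GrauertRemmert1971]
* J. M. Ruiz, *The basic theory of power series*, Advanced Lectures in Math., Vieweg (1993),
  §§1–3. [Ruiz1993]
* J. Denef, L. van den Dries, *p-adic and real subanalytic sets*, Ann. of Math. 128 (1988),
  79–138, §4. [DenefvandenDries1988]
-/

noncomputable section

open MvPowerSeries Finsupp Filter
open scoped NNReal ENNReal Topology BigOperators

namespace Literature.RingTheory.MvPowerSeries

variable {σ : Type*} {𝕜 : Type*} [NormedField 𝕜]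

/-! ### 1. Weights of monomials -/

/-- The weight `ρ^α = ∏ᵢ ρᵢ ^ αᵢ` of the monomial `x^α` with respect to the polyradius `ρ`.
[cite: GrauertRemmert1971, Kap. I §1] -/
def wt (ρ : σ → ℝ≥0) (α : σ →₀ ℕ) : ℝ≥0 :=
  α.prod fun i k => ρ i ^ k

/-- `ρ^0 = 1`. [folklore] -/
@[simp] theorem wt_zero (ρ : σ → ℝ≥0) : wt ρ 0 = 1 := by
  simp [wt]

/-- `ρ^(α+β) = ρ^α ρ^β`. [folklore] -/
theorem wt_add (ρ : σ → ℝ≥0) (α β : σ →₀ ℕ) : wt ρ (α + β) = wt ρ α * wt ρ β := by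
  classical
  unfold wt
  exact Finsupp.prod_add_index' (fun i => pow_zero _) (fun i k l => pow_add _ _ _)

/-- `ρ^(single i k) = ρᵢ ^ k`. [folklore] -/
@[simp] theorem wt_single (ρ : σ → ℝ≥0) (i : σ) (k : ℕ) : wt ρ (single i k) = ρ i ^ k := by
  simp [wt, Finsupp.prod_single_index]

/-- Weights as a finite product over the support. [folklore] -/
theorem wt_eq_prod (ρ : σ → ℝ≥0) (α : σ →₀ ℕ) :
    wt ρ α = ∏ i ∈ α.support, ρ i ^ α i := rfl

/-- Weights are monotone in the polyradius. [folklore] -/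
theorem wt_mono {ρ ρ' : σ → ℝ≥0} (h : ∀ i, ρ i ≤ ρ' i) (α : σ →₀ ℕ) : wt ρ α ≤ wt ρ' α := by
  rw [wt_eq_prod, wt_eq_prod]
  exact Finset.prod_le_prod (fun i _ => zero_le) fun i _ => pow_le_pow_left₀ zero_le (h i) _

/-- Weights are positive for a positive polyradius. [folklore] -/
theorem wt_pos {ρ : σ → ℝ≥0} (h : ∀ i, 0 < ρ i) (α : σ →₀ ℕ) : 0 < wt ρ α := by
  rw [wt_eq_prod]
  exact Finset.prod_pos fun i _ => pow_pos (h i) _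

/-- Scaling the polyradius by `c` scales `ρ^α` by `c ^ |α|`. [folklore] -/
theorem wt_smul (c : ℝ≥0) (ρ : σ → ℝ≥0) (α : σ →₀ ℕ) :
    wt (fun i => c * ρ i) α = c ^ α.degree * wt ρ α := by
  rw [wt_eq_prod, wt_eq_prod, Finsupp.degree_apply]
  simp only [mul_pow, Finset.prod_mul_distrib, Finset.prod_pow_eq_pow_sum]

/-- For `c ≤ 1` and `α ≠ 0`, `(cρ)^α ≤ c ρ^α`. [folklore] -/
theorem wt_smul_le {c : ℝ≥0} (hc : c ≤ 1) (ρ : σ → ℝ≥0) {α : σ →₀ ℕ} (hα : α ≠ 0) :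
    wt (fun i => c * ρ i) α ≤ c * wt ρ α := by
  rw [wt_smul]
  refine mul_le_mul_of_nonneg_right ?_ zero_le
  have h1 : 1 ≤ α.degree := by
    rw [Nat.one_le_iff_ne_zero]
    exact fun h => hα ((Finsupp.degree_eq_zero_iff α).mp h)
  calc c ^ α.degree ≤ c ^ 1 := pow_le_pow_of_le_one zero_le hc h1
    _ = c := pow_one c

/-! ### 2. The weighted `ℓ¹`-norms -/

/-- The weighted `ℓ¹`-norm `‖f‖_ρ = ∑_α ‖f_α‖ ρ^α ∈ [0, ∞]` of a power series.
[cite: GrauertRemmert1971, Kap. I §1] -/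
def wnorm (ρ : σ → ℝ≥0) (f : MvPowerSeries σ 𝕜) : ℝ≥0∞ :=
  ∑' α, ((‖coeff α f‖₊ * wt ρ α : ℝ≥0) : ℝ≥0∞)

/-- Every coefficient is dominated: `‖f_α‖ ρ^α ≤ ‖f‖_ρ`. [folklore] -/
theorem coeff_mul_wt_le_wnorm (ρ : σ → ℝ≥0) (f : MvPowerSeries σ 𝕜) (α : σ →₀ ℕ) :
    ((‖coeff α f‖₊ * wt ρ α : ℝ≥0) : ℝ≥0∞) ≤ wnorm ρ f :=
  ENNReal.le_tsum (f := fun α => ((‖coeff α f‖₊ * wt ρ α : ℝ≥0) : ℝ≥0∞)) α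

/-- Coefficient bound `‖f_α‖ ≤ ‖f‖_ρ / ρ^α` in the form `‖f_α‖ ρ^α ≤ ‖f‖_ρ` over `ℝ≥0`,
when `‖f‖_ρ < ∞`. [folklore] -/
theorem nnnorm_coeff_mul_wt_le {ρ : σ → ℝ≥0} {f : MvPowerSeries σ 𝕜} (α : σ →₀ ℕ)
    (hf : wnorm ρ f ≠ ⊤) : ‖coeff α f‖₊ * wt ρ α ≤ (wnorm ρ f).toNNReal := by
  have h := coeff_mul_wt_le_wnorm ρ f α
  rw [← ENNReal.coe_toNNReal hf] at h
  exact_mod_cast h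

/-- `‖0‖_ρ = 0`. [folklore] -/
@[simp] theorem wnorm_zero (ρ : σ → ℝ≥0) : wnorm ρ (0 : MvPowerSeries σ 𝕜) = 0 := by
  simp [wnorm]

/-- `‖f‖_ρ = 0` forces `f = 0` when all radii are positive. [folklore] -/
theorem eq_zero_of_wnorm_eq_zero {ρ : σ → ℝ≥0} (hρ : ∀ i, 0 < ρ i) {f : MvPowerSeries σ 𝕜}
    (h : wnorm ρ f = 0) : f = 0 := by
  ext α
  have hα := coeff_mul_wt_le_wnorm ρ f α
  rw [h, nonpos_iff_eq_zero, ENNReal.coe_eq_zero, mul_eq_zero] at hα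
  rcases hα with hα | hα
  · simpa using hα
  · exact absurd hα (wt_pos hρ α).ne'

/-- Triangle inequality `‖f + g‖_ρ ≤ ‖f‖_ρ + ‖g‖_ρ`. [folklore] -/
theorem wnorm_add_le (ρ : σ → ℝ≥0) (f g : MvPowerSeries σ 𝕜) :
    wnorm ρ (f + g) ≤ wnorm ρ f + wnorm ρ g := by
  unfold wnorm
  rw [← ENNReal.tsum_add]
  refine ENNReal.tsum_le_tsum fun α => ?_
  rw [← ENNReal.coe_add, ENNReal.coe_le_coe, map_add, ← add_mul]
  exact mul_le_mul_of_nonneg_right (nnnorm_add_le _ _) zero_le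

/-- `‖-f‖_ρ = ‖f‖_ρ`. [folklore] -/
@[simp] theorem wnorm_neg (ρ : σ → ℝ≥0) (f : MvPowerSeries σ 𝕜) : wnorm ρ (-f) = wnorm ρ f := by
  simp [wnorm]

/-- `‖f - g‖_ρ ≤ ‖f‖_ρ + ‖g‖_ρ`. [folklore] -/
theorem wnorm_sub_le (ρ : σ → ℝ≥0) (f g : MvPowerSeries σ 𝕜) :
    wnorm ρ (f - g) ≤ wnorm ρ f + wnorm ρ g := by
  simpa [sub_eq_add_neg] using wnorm_add_le ρ f (-g)

/-- Finite subadditivity. [folklore] -/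
theorem wnorm_sum_le {ι : Type*} (ρ : σ → ℝ≥0) (s : Finset ι) (f : ι → MvPowerSeries σ 𝕜) :
    wnorm ρ (∑ i ∈ s, f i) ≤ ∑ i ∈ s, wnorm ρ (f i) := by
  classical
  induction s using Finset.induction_on with
  | empty => simp
  | insert a s ha ih =>
    rw [Finset.sum_insert ha, Finset.sum_insert ha]
    exact (wnorm_add_le ρ _ _).trans (add_le_add le_rfl ih)

/-- Homogeneity `‖c • f‖_ρ = ‖c‖ ‖f‖_ρ`. [folklore] -/
theorem wnorm_smul (ρ : σ → ℝ≥0) (c : 𝕜) (f : MvPowerSeries σ 𝕜) :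
    wnorm ρ (c • f) = ‖c‖₊ * wnorm ρ f := by
  unfold wnorm
  rw [← ENNReal.tsum_mul_left]
  refine tsum_congr fun α => ?_
  rw [map_smul, smul_eq_mul, nnnorm_mul, ← ENNReal.coe_mul, mul_assoc]

/-- `‖C c * f‖_ρ = ‖c‖ ‖f‖_ρ`. [folklore] -/
theorem wnorm_C_mul (ρ : σ → ℝ≥0) (c : 𝕜) (f : MvPowerSeries σ 𝕜) :
    wnorm ρ (C c * f) = ‖c‖₊ * wnorm ρ f := by
  rw [← smul_eq_C_mul, wnorm_smul]

/-- The norm of a monomial: `‖a x^α‖_ρ = ‖a‖ ρ^α`. [folklore] -/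
theorem wnorm_monomial (ρ : σ → ℝ≥0) (α : σ →₀ ℕ) (a : 𝕜) :
    wnorm ρ (monomial α a) = ((‖a‖₊ * wt ρ α : ℝ≥0) : ℝ≥0∞) := by
  classical
  unfold wnorm
  rw [tsum_eq_single α]
  · rw [coeff_monomial_same]
  · intro β hβ
    rw [coeff_monomial_ne hβ, nnnorm_zero, zero_mul, ENNReal.coe_zero]

/-- The norm of a constant: `‖C a‖_ρ = ‖a‖`. [folklore] -/
@[simp] theorem wnorm_C (ρ : σ → ℝ≥0) (a : 𝕜) : wnorm ρ (C a : MvPowerSeries σ 𝕜) = ‖a‖₊ := by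
  rw [← monomial_zero_eq_C_apply, wnorm_monomial, wt_zero, mul_one]

/-- `‖1‖_ρ = 1`. [folklore] -/
@[simp] theorem wnorm_one (ρ : σ → ℝ≥0) : wnorm ρ (1 : MvPowerSeries σ 𝕜) = 1 := by
  rw [← (C : 𝕜 →+* MvPowerSeries σ 𝕜).map_one, wnorm_C, nnnorm_one, ENNReal.coe_one]

/-- The norm of a variable: `‖xᵢ‖_ρ = ρᵢ`. [folklore] -/
@[simp] theorem wnorm_X (ρ : σ → ℝ≥0) (i : σ) : wnorm ρ (X i : MvPowerSeries σ 𝕜) = ρ i := by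
  rw [X_def, wnorm_monomial, nnnorm_one, one_mul, wt_single, pow_one]

/-- Monotonicity in the polyradius. [folklore] -/
theorem wnorm_mono {ρ ρ' : σ → ℝ≥0} (h : ∀ i, ρ i ≤ ρ' i) (f : MvPowerSeries σ 𝕜) :
    wnorm ρ f ≤ wnorm ρ' f :=
  ENNReal.tsum_le_tsum fun α => ENNReal.coe_le_coe.mpr
    (mul_le_mul_of_nonneg_left (wt_mono h α) zero_le)

/-- The constant coefficient is dominated: `‖f(0)‖ ≤ ‖f‖_ρ`. [folklore] -/
theorem nnnorm_constantCoeff_le_wnorm (ρ : σ → ℝ≥0) (f : MvPowerSeries σ 𝕜) :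
    (‖constantCoeff f‖₊ : ℝ≥0∞) ≤ wnorm ρ f := by
  simpa using coeff_mul_wt_le_wnorm ρ f 0

/-- Shrinking the polyradius by `c ≤ 1` shrinks the norm of a series without constant term by `c`:
`‖f‖_{cρ} ≤ c ‖f‖_ρ`. [cite: GrauertRemmert1971, Kap. I §1] -/
theorem wnorm_smul_le_of_constantCoeff_eq_zero {c : ℝ≥0} (hc : c ≤ 1) (ρ : σ → ℝ≥0)
    {f : MvPowerSeries σ 𝕜} (hf : constantCoeff f = 0) :
    wnorm (fun i => c * ρ i) f ≤ c * wnorm ρ f := by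
  unfold wnorm
  rw [← ENNReal.tsum_mul_left]
  refine ENNReal.tsum_le_tsum fun α => ?_
  by_cases hα : α = 0
  · subst hα
    simp [hf]
  · rw [← ENNReal.coe_mul, ENNReal.coe_le_coe, mul_left_comm]
    exact mul_le_mul_of_nonneg_left (wt_smul_le hc ρ hα) zero_le

/-- The norm splits off the constant term: `‖f‖_ρ = ‖f(0)‖ + ‖f - f(0)‖_ρ`. [folklore] -/
theorem wnorm_eq_constantCoeff_add (ρ : σ → ℝ≥0) (f : MvPowerSeries σ 𝕜) :
    wnorm ρ f = ‖constantCoeff f‖₊ + wnorm ρ (f - C (constantCoeff f)) := by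
  classical
  unfold wnorm
  rw [ENNReal.tsum_eq_add_tsum_ite (0 : σ →₀ ℕ)]
  conv_rhs => rw [ENNReal.tsum_eq_add_tsum_ite (0 : σ →₀ ℕ)]
  have h0 : ((‖coeff 0 (f - C (constantCoeff f))‖₊ * wt ρ 0 : ℝ≥0) : ℝ≥0∞) = 0 := by
    simp
  rw [h0, zero_add, coeff_zero_eq_constantCoeff_apply, wt_zero, mul_one]
  congr 1
  refine tsum_congr fun α => ?_
  by_cases hα : α = 0
  · rw [if_pos hα, if_pos hα]
  · rw [if_neg hα, if_neg hα, map_sub, coeff_C, if_neg hα, sub_zero]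

/-! ### 3. Submultiplicativity -/

/-- **`‖f g‖_ρ ≤ ‖f‖_ρ ‖g‖_ρ`**: the weighted `ℓ¹`-norms are submultiplicative (Cauchy product
and `ρ^(α+β) = ρ^α ρ^β`). [cite: GrauertRemmert1971, Kap. I §1] -/
theorem wnorm_mul_le (ρ : σ → ℝ≥0) (f g : MvPowerSeries σ 𝕜) :
    wnorm ρ (f * g) ≤ wnorm ρ f * wnorm ρ g := by
  classical
  -- the summands, as a function on pairs
  set F : (σ →₀ ℕ) × (σ →₀ ℕ) → ℝ≥0∞ := fun p =>
    ((‖coeff p.1 f‖₊ * wt ρ p.1 : ℝ≥0) : ℝ≥0∞) * ((‖coeff p.2 g‖₊ * wt ρ p.2 : ℝ≥0) : ℝ≥0∞)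
  have hprod : wnorm ρ f * wnorm ρ g = ∑' p : (σ →₀ ℕ) × (σ →₀ ℕ), F p := by
    unfold wnorm
    rw [← ENNReal.tsum_mul_right]
    simp_rw [← ENNReal.tsum_mul_left]
    exact (ENNReal.tsum_prod (f := fun a b => F (a, b))).symm
  rw [hprod, ← (Finset.HasAntidiagonal.sigmaAntidiagonalEquivProd (A := σ →₀ ℕ)).tsum_eq F,
    ENNReal.tsum_sigma']
  refine ENNReal.tsum_le_tsum fun γ => ?_
  rw [tsum_fintype (L := SummationFilter.unconditional _), Finset.sum_coe_sort_eq_attach,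
    coeff_mul]
  calc (((‖∑ p ∈ Finset.antidiagonal γ, coeff p.1 f * coeff p.2 g‖₊ * wt ρ γ : ℝ≥0)) : ℝ≥0∞)
      ≤ ∑ p ∈ Finset.antidiagonal γ, (((‖coeff p.1 f * coeff p.2 g‖₊ * wt ρ γ : ℝ≥0)) : ℝ≥0∞) := by
        rw [← ENNReal.ofNNReal_finsetSum, ENNReal.coe_le_coe, ← Finset.sum_mul]
        exact mul_le_mul_of_nonneg_right (nnnorm_sum_le _ _) zero_le
    _ = ∑ p ∈ (Finset.antidiagonal γ).attach, F (Finset.HasAntidiagonal.sigmaAntidiagonalEquivProd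
          ⟨γ, p⟩) := by
        rw [← Finset.sum_attach]
        refine Finset.sum_congr rfl fun p _ => ?_
        have hp : p.1.1 + p.1.2 = γ := Finset.mem_antidiagonal.mp p.2
        simp only [F, Finset.HasAntidiagonal.sigmaAntidiagonalEquivProd_apply]
        have hw := wt_add ρ (↑p : (σ →₀ ℕ) × (σ →₀ ℕ)).1 (↑p : (σ →₀ ℕ) × (σ →₀ ℕ)).2
        rw [hp] at hw
        rw [← ENNReal.coe_mul, nnnorm_mul, hw]
        push_cast
        ring

/-- `‖f ^ k‖_ρ ≤ ‖f‖_ρ ^ k`. [folklore] -/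
theorem wnorm_pow_le (ρ : σ → ℝ≥0) (f : MvPowerSeries σ 𝕜) (k : ℕ) :
    wnorm ρ (f ^ k) ≤ wnorm ρ f ^ k := by
  induction k with
  | zero => simp
  | succ k ih =>
    rw [pow_succ, pow_succ]
    exact (wnorm_mul_le ρ _ _).trans (mul_le_mul' ih le_rfl)

/-- `‖∏ fᵢ‖_ρ ≤ ∏ ‖fᵢ‖_ρ`. [folklore] -/
theorem wnorm_prod_le {ι : Type*} (ρ : σ → ℝ≥0) (s : Finset ι) (f : ι → MvPowerSeries σ 𝕜) :
    wnorm ρ (∏ i ∈ s, f i) ≤ ∏ i ∈ s, wnorm ρ (f i) := by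
  classical
  induction s using Finset.induction_on with
  | empty => simp
  | insert a s ha ih =>
    rw [Finset.prod_insert ha, Finset.prod_insert ha]
    exact (wnorm_mul_le ρ _ _).trans (mul_le_mul' le_rfl ih)

/-- `‖f^α‖_ρ ≤ ∏ ‖fᵢ‖_ρ ^ αᵢ` for a family `f` and a multi-exponent `α`. [folklore] -/
theorem wnorm_finsuppProd_pow_le {τ : Type*} (ρ : σ → ℝ≥0) (f : τ → MvPowerSeries σ 𝕜)
    (α : τ →₀ ℕ) :
    wnorm ρ (α.prod fun i k => f i ^ k) ≤ α.prod fun i k => wnorm ρ (f i) ^ k := by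
  unfold Finsupp.prod
  exact (wnorm_prod_le ρ _ _).trans (Finset.prod_le_prod' fun i _ => wnorm_pow_le ρ _ _)

/-! ### 4. Countable subadditivity for coefficientwise convergent sums -/

section PiTopology

open MvPowerSeries.WithPiTopology

/-- If `∑ᵢ fᵢ` converges coefficientwise (product topology), then
`‖∑ᵢ fᵢ‖_ρ ≤ ∑ᵢ ‖fᵢ‖_ρ`. [folklore] -/
theorem wnorm_tsum_le {ι : Type*} (ρ : σ → ℝ≥0) {f : ι → MvPowerSeries σ 𝕜} (hf : Summable f) :
    wnorm ρ (∑' i, f i) ≤ ∑' i, wnorm ρ (f i) := by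
  unfold wnorm
  rw [ENNReal.tsum_comm]
  refine ENNReal.tsum_le_tsum fun α => ?_
  have hα : coeff α (∑' i, f i) = ∑' i, coeff α (f i) :=
    ((hf.hasSum.map (coeff α) (continuous_coeff 𝕜 α)).tsum_eq).symm
  rw [hα]
  calc (((‖∑' i, coeff α (f i)‖₊ * wt ρ α : ℝ≥0)) : ℝ≥0∞)
      = ‖∑' i, coeff α (f i)‖ₑ * wt ρ α := by
        rw [ENNReal.coe_mul]; rfl
    _ ≤ (∑' i, ‖coeff α (f i)‖ₑ) * wt ρ α :=
        mul_le_mul_of_nonneg_right enorm_tsum_le_tsum_enorm zero_le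
    _ = ∑' i, (((‖coeff α (f i)‖₊ * wt ρ α : ℝ≥0)) : ℝ≥0∞) := by
        rw [← ENNReal.tsum_mul_right]
        rfl

end PiTopology

/-! ### 5. Convergent power series -/

/-- A power series is **convergent** if `‖f‖_ρ < ∞` for some polyradius with all `ρᵢ > 0`
(Grauert–Remmert: `f ∈ B_ρ` for some `ρ`). [cite: GrauertRemmert1971, Kap. I §1] -/
def HasPosRadius (f : MvPowerSeries σ 𝕜) : Prop :=
  ∃ ρ : σ → ℝ≥0, (∀ i, 0 < ρ i) ∧ wnorm ρ f < ⊤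

/-- A finite norm at `ρ'` gives a finite norm at every smaller `ρ`. [folklore] -/
theorem wnorm_lt_top_mono {ρ ρ' : σ → ℝ≥0} (h : ∀ i, ρ i ≤ ρ' i) {f : MvPowerSeries σ 𝕜}
    (hf : wnorm ρ' f < ⊤) : wnorm ρ f < ⊤ :=
  (wnorm_mono h f).trans_lt hf

namespace HasPosRadius

/-- Two convergent series have a common polyradius of convergence. [folklore] -/
theorem exists_common {f g : MvPowerSeries σ 𝕜} (hf : HasPosRadius f) (hg : HasPosRadius g) :
    ∃ ρ : σ → ℝ≥0, (∀ i, 0 < ρ i) ∧ wnorm ρ f < ⊤ ∧ wnorm ρ g < ⊤ := by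
  obtain ⟨ρ₁, h₁, hf⟩ := hf
  obtain ⟨ρ₂, h₂, hg⟩ := hg
  refine ⟨fun i => min (ρ₁ i) (ρ₂ i), fun i => lt_min (h₁ i) (h₂ i), ?_, ?_⟩
  · exact wnorm_lt_top_mono (fun i => min_le_left _ _) hf
  · exact wnorm_lt_top_mono (fun i => min_le_right _ _) hg

/-- A finite family of convergent series has a common polyradius of convergence. [folklore] -/
theorem exists_common_finset {ι : Type*} (s : Finset ι) {f : ι → MvPowerSeries σ 𝕜}
    (hf : ∀ i ∈ s, HasPosRadius (f i)) (ρ₀ : σ → ℝ≥0) (h₀ : ∀ i, 0 < ρ₀ i) :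
    ∃ ρ : σ → ℝ≥0, (∀ i, 0 < ρ i) ∧ (∀ i, ρ i ≤ ρ₀ i) ∧ ∀ i ∈ s, wnorm ρ (f i) < ⊤ := by
  classical
  induction s using Finset.induction_on with
  | empty => exact ⟨ρ₀, h₀, fun i => le_rfl, fun i hi => absurd hi (Finset.notMem_empty _)⟩
  | insert a s ha ih =>
    obtain ⟨ρ, hρ, hρ₀, hs⟩ := ih fun i hi => hf i (Finset.mem_insert_of_mem hi)
    obtain ⟨ρ₁, h₁, ha'⟩ := hf a (Finset.mem_insert_self a s)
    refine ⟨fun i => min (ρ i) (ρ₁ i), fun i => lt_min (hρ i) (h₁ i),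
      fun i => (min_le_left _ _).trans (hρ₀ i), fun i hi => ?_⟩
    rcases Finset.mem_insert.mp hi with rfl | hi
    · exact wnorm_lt_top_mono (fun i => min_le_right _ _) ha'
    · exact wnorm_lt_top_mono (fun i => min_le_left _ _) (hs i hi)

/-- `0` is convergent (given a positive polyradius exists, e.g. the constant `1`). [folklore] -/
theorem zero : HasPosRadius (0 : MvPowerSeries σ 𝕜) :=
  ⟨fun _ => 1, fun _ => one_pos, by simp⟩

/-- Constants are convergent. [folklore] -/
theorem C (a : 𝕜) : HasPosRadius (C a : MvPowerSeries σ 𝕜) :=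
  ⟨fun _ => 1, fun _ => one_pos, by simp⟩

/-- `1` is convergent. [folklore] -/
theorem one : HasPosRadius (1 : MvPowerSeries σ 𝕜) :=
  ⟨fun _ => 1, fun _ => one_pos, by simp⟩

/-- Monomials are convergent. [folklore] -/
theorem monomial (α : σ →₀ ℕ) (a : 𝕜) : HasPosRadius (monomial α a : MvPowerSeries σ 𝕜) :=
  ⟨fun _ => 1, fun _ => one_pos, by rw [wnorm_monomial]; exact ENNReal.coe_lt_top⟩

/-- Variables are convergent. [folklore] -/
theorem X (i : σ) : HasPosRadius (X i : MvPowerSeries σ 𝕜) :=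
  ⟨fun _ => 1, fun _ => one_pos, by simp⟩

/-- Sums of convergent series are convergent. [folklore] -/
theorem add {f g : MvPowerSeries σ 𝕜} (hf : HasPosRadius f) (hg : HasPosRadius g) :
    HasPosRadius (f + g) := by
  obtain ⟨ρ, hρ, hf, hg⟩ := hf.exists_common hg
  exact ⟨ρ, hρ, (wnorm_add_le ρ f g).trans_lt (ENNReal.add_lt_top.mpr ⟨hf, hg⟩)⟩

/-- Negatives of convergent series are convergent. [folklore] -/
theorem neg {f : MvPowerSeries σ 𝕜} (hf : HasPosRadius f) : HasPosRadius (-f) := by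
  obtain ⟨ρ, hρ, hf⟩ := hf
  exact ⟨ρ, hρ, by rwa [wnorm_neg]⟩

/-- Differences of convergent series are convergent. [folklore] -/
theorem sub {f g : MvPowerSeries σ 𝕜} (hf : HasPosRadius f) (hg : HasPosRadius g) :
    HasPosRadius (f - g) := by
  rw [sub_eq_add_neg]; exact hf.add hg.neg

/-- Products of convergent series are convergent. [folklore] -/
theorem mul {f g : MvPowerSeries σ 𝕜} (hf : HasPosRadius f) (hg : HasPosRadius g) :
    HasPosRadius (f * g) := by
  obtain ⟨ρ, hρ, hf, hg⟩ := hf.exists_common hg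
  exact ⟨ρ, hρ, (wnorm_mul_le ρ f g).trans_lt (ENNReal.mul_lt_top hf hg)⟩

/-- Scalar multiples of convergent series are convergent. [folklore] -/
theorem smul (c : 𝕜) {f : MvPowerSeries σ 𝕜} (hf : HasPosRadius f) : HasPosRadius (c • f) := by
  obtain ⟨ρ, hρ, hf⟩ := hf
  exact ⟨ρ, hρ, by rw [wnorm_smul]; exact ENNReal.mul_lt_top ENNReal.coe_lt_top hf⟩

/-- Powers of convergent series are convergent. [folklore] -/
theorem pow {f : MvPowerSeries σ 𝕜} (hf : HasPosRadius f) (k : ℕ) : HasPosRadius (f ^ k) := by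
  induction k with
  | zero => simpa using one
  | succ k ih => rw [pow_succ]; exact ih.mul hf

end HasPosRadius

variable (σ 𝕜) in
/-- **The algebra `𝕜{x}` of convergent power series** as a subalgebra of `𝕜⟦x⟧`.
[cite: GrauertRemmert1971, Kap. I §1] -/
def convergent : Subalgebra 𝕜 (MvPowerSeries σ 𝕜) where
  carrier := {f | HasPosRadius f}
  mul_mem' hf hg := hf.mul hg
  add_mem' hf hg := hf.add hg
  algebraMap_mem' a := HasPosRadius.C a

/-! ### 6. Units -/

section Units

open MvPowerSeries.WithPiTopology

/-- **Geometric series bound**: if `g(0) = 0` then `‖(1 - g)⁻¹‖_ρ ≤ (1 - ‖g‖_ρ)⁻¹`; in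
particular the inverse lies in `B_ρ` as soon as `‖g‖_ρ < 1`.
[cite: GrauertRemmert1971, Kap. I §2] -/
theorem wnorm_inv_one_sub_le (ρ : σ → ℝ≥0) {g : MvPowerSeries σ 𝕜} (hg : constantCoeff g = 0) :
    wnorm ρ (1 - g)⁻¹ ≤ (1 - wnorm ρ g)⁻¹ := by
  have h1 : constantCoeff (1 - g) ≠ 0 := by simp [hg]
  have hinv : (∑' k : ℕ, g ^ k) = (1 - g)⁻¹ :=
    (MvPowerSeries.eq_inv_iff_mul_eq_one h1).mpr (tsum_pow_mul_one_sub_of_constantCoeff_eq_zero hg)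
  rw [← hinv, ← ENNReal.tsum_geometric]
  refine (wnorm_tsum_le ρ (summable_pow_of_constantCoeff_eq_zero hg)).trans ?_
  exact ENNReal.tsum_le_tsum fun k => wnorm_pow_le ρ g k

/-- If `g(0) = 0` and `‖g‖_ρ < 1` then `‖(1 - g)⁻¹‖_ρ < ∞`. [cite: GrauertRemmert1971, Kap. I §2] -/
theorem wnorm_inv_one_sub_lt_top (ρ : σ → ℝ≥0) {g : MvPowerSeries σ 𝕜} (hg : constantCoeff g = 0)
    (h : wnorm ρ g < 1) : wnorm ρ (1 - g)⁻¹ < ⊤ :=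
  (wnorm_inv_one_sub_le ρ hg).trans_lt (ENNReal.inv_lt_top.mpr (tsub_pos_of_lt h))

/-- **Shrinking the polyradius makes a series without constant term small**: if `‖g‖_ρ < ∞` and
`g(0) = 0`, then for every `ε > 0` there is `0 < t ≤ 1` with `‖g‖_{tρ} < ε`. [folklore] -/
theorem exists_wnorm_smul_lt {ρ : σ → ℝ≥0} {g : MvPowerSeries σ 𝕜} (hg : constantCoeff g = 0)
    (hfin : wnorm ρ g < ⊤) {ε : ℝ≥0∞} (hε : 0 < ε) :
    ∃ t : ℝ≥0, 0 < t ∧ t ≤ 1 ∧ wnorm (fun i => t * ρ i) g < ε := by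
  set M : ℝ≥0 := (wnorm ρ g).toNNReal with hM
  have hMeq : wnorm ρ g = M := (ENNReal.coe_toNNReal hfin.ne).symm
  -- choose t with t * M < ε and t ≤ 1
  by_cases hεtop : ε = ⊤
  · refine ⟨1, one_pos, le_rfl, ?_⟩
    rw [hεtop]
    simpa using hfin
  set e : ℝ≥0 := ε.toNNReal with he
  have heeq : ε = e := (ENNReal.coe_toNNReal hεtop).symm
  have hepos : 0 < e := by
    rw [heeq] at hε; exact_mod_cast hε
  refine ⟨min 1 (e / (2 * (M + 1))), lt_min one_pos (div_pos hepos (by positivity)),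
    min_le_left _ _, ?_⟩
  calc wnorm (fun i => min 1 (e / (2 * (M + 1))) * ρ i) g
      ≤ min 1 (e / (2 * (M + 1))) * wnorm ρ g :=
        wnorm_smul_le_of_constantCoeff_eq_zero (min_le_left _ _) ρ hg
    _ ≤ (e / (2 * (M + 1)) : ℝ≥0) * (M : ℝ≥0∞) := by
        rw [hMeq]
        exact mul_le_mul_of_nonneg_right (ENNReal.coe_le_coe.mpr (min_le_right _ _)) zero_le
    _ < ε := by
        rw [heeq, ← ENNReal.coe_mul, ENNReal.coe_lt_coe]
        calc e / (2 * (M + 1)) * M ≤ e / (2 * (M + 1)) * (M + 1) :=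
              mul_le_mul_of_nonneg_left (le_add_of_nonneg_right zero_le) zero_le
          _ = e / 2 := by field_simp
          _ < e := NNReal.half_lt_self hepos.ne'

/-- **Units of `𝕜{x}`**: a power series in `B_ρ` with non-zero constant coefficient has its
inverse in some `B_{tρ}`, `0 < t ≤ 1`. [cite: GrauertRemmert1971, Kap. I §2] -/
theorem exists_wnorm_inv_lt_top {ρ : σ → ℝ≥0} {f : MvPowerSeries σ 𝕜} (hfin : wnorm ρ f < ⊤)
    (h0 : constantCoeff f ≠ 0) :
    ∃ t : ℝ≥0, 0 < t ∧ t ≤ 1 ∧ wnorm (fun i => t * ρ i) f⁻¹ < ⊤ := by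
  set c := constantCoeff f with hc
  -- `f = C c * (1 - g)` with `g = 1 - C c⁻¹ * f`, `g(0) = 0`
  set g : MvPowerSeries σ 𝕜 := 1 - C c⁻¹ * f with hg
  have hg0 : constantCoeff g = 0 := by
    simp only [hg, map_sub, map_one, map_mul, constantCoeff_C, ← hc, inv_mul_cancel₀ h0, sub_self]
  have hgfin : wnorm ρ g < ⊤ := by
    refine (wnorm_sub_le ρ _ _).trans_lt (ENNReal.add_lt_top.mpr ⟨by simp, ?_⟩)
    rw [wnorm_C_mul]
    exact ENNReal.mul_lt_top ENNReal.coe_lt_top hfin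
  obtain ⟨t, ht, ht1, hlt⟩ := exists_wnorm_smul_lt hg0 hgfin one_pos
  refine ⟨t, ht, ht1, ?_⟩
  have hf : f = C c * (1 - g) := by
    simp only [hg, sub_sub_cancel, ← mul_assoc, ← map_mul, mul_inv_cancel₀ h0, map_one, one_mul]
  have hinv : f⁻¹ = (1 - g)⁻¹ * C c⁻¹ := by
    rw [hf, MvPowerSeries.mul_inv_rev, C_inv]
  rw [hinv, mul_comm, wnorm_C_mul]
  exact ENNReal.mul_lt_top ENNReal.coe_lt_top (wnorm_inv_one_sub_lt_top _ hg0 hlt)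

/-- The inverse of a convergent series with non-zero constant coefficient is convergent.
[cite: GrauertRemmert1971, Kap. I §2] -/
theorem HasPosRadius.inv {f : MvPowerSeries σ 𝕜} (hf : HasPosRadius f) (h0 : constantCoeff f ≠ 0) :
    HasPosRadius f⁻¹ := by
  obtain ⟨ρ, hρ, hfin⟩ := hf
  obtain ⟨t, ht, -, h⟩ := exists_wnorm_inv_lt_top hfin h0
  exact ⟨fun i => t * ρ i, fun i => mul_pos ht (hρ i), h⟩

/-- **`𝕜{x}` is local**: a convergent power series is a unit of `convergent σ 𝕜` iff its
constant coefficient is non-zero. [cite: GrauertRemmert1971, Kap. I §2] -/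
theorem isUnit_iff_constantCoeff_ne_zero (f : convergent σ 𝕜) :
    IsUnit f ↔ constantCoeff (f : MvPowerSeries σ 𝕜) ≠ 0 := by
  constructor
  · intro hu
    have hu' : IsUnit (f : MvPowerSeries σ 𝕜) := hu.map (convergent σ 𝕜).val
    exact (MvPowerSeries.isUnit_iff_constantCoeff.mp hu').ne_zero
  · intro h0
    have hinv : HasPosRadius (f : MvPowerSeries σ 𝕜)⁻¹ := HasPosRadius.inv f.2 h0
    refine ⟨⟨f, ⟨(f : MvPowerSeries σ 𝕜)⁻¹, hinv⟩, ?_, ?_⟩, rfl⟩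
    · exact Subtype.ext (MvPowerSeries.mul_inv_cancel _ h0)
    · exact Subtype.ext (MvPowerSeries.inv_mul_cancel _ h0)

end Units

/-! ### 7. Rescaling and substitution -/

/-- **Rescaling**: `‖f(a x)‖_ρ = ‖f‖_{‖a‖ ρ}`. [folklore] -/
theorem wnorm_rescale (ρ : σ → ℝ≥0) (a : σ → 𝕜) (f : MvPowerSeries σ 𝕜) :
    wnorm ρ (rescale a f) = wnorm (fun i => ‖a i‖₊ * ρ i) f := by
  unfold wnorm
  refine tsum_congr fun α => ?_
  rw [coeff_rescale, nnnorm_mul, mul_comm (‖(α.prod fun s m => a s ^ m)‖₊), mul_assoc]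
  congr 3
  rw [wt_eq_prod, wt_eq_prod, Finsupp.prod, nnnorm_prod, ← Finset.prod_mul_distrib]
  exact Finset.prod_congr rfl fun i _ => by rw [nnnorm_pow, mul_pow]

/-- Rescaling preserves convergence. [folklore] -/
theorem HasPosRadius.rescale {f : MvPowerSeries σ 𝕜} (hf : HasPosRadius f) (a : σ → 𝕜) :
    HasPosRadius (rescale a f) := by
  obtain ⟨ρ, hρ, hfin⟩ := hf
  -- radius ρᵢ / max 1 ‖aᵢ‖
  refine ⟨fun i => ρ i / max 1 ‖a i‖₊, fun i => div_pos (hρ i) (by positivity), ?_⟩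
  rw [wnorm_rescale]
  refine wnorm_lt_top_mono (fun i => ?_) hfin
  rw [mul_div_assoc', div_le_iff₀ (by positivity)]
  exact mul_le_mul_of_nonneg_right (le_max_right _ _) zero_le |>.trans_eq (mul_comm _ _)

section Subst

variable {τ : Type*}

/-- Pointwise bound for the coefficients of a substitution:
`‖(f(a))_e‖ ≤ ∑_d ‖f_d‖ ‖(a^d)_e‖`. [folklore] -/
theorem nnnorm_coeff_subst_le {a : σ → MvPowerSeries τ 𝕜} (ha : HasSubst a)
    (f : MvPowerSeries σ 𝕜) (e : τ →₀ ℕ) :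
    (‖coeff e (subst a f)‖₊ : ℝ≥0∞) ≤
      ∑' d : σ →₀ ℕ, ((‖coeff d f‖₊ * ‖coeff e (d.prod fun s m => a s ^ m)‖₊ : ℝ≥0) : ℝ≥0∞) := by
  classical
  rw [coeff_subst ha f e, finsum_eq_sum _ (coeff_subst_finite ha f e)]
  refine le_trans ?_ (ENNReal.sum_le_tsum (coeff_subst_finite ha f e).toFinset)
  rw [← ENNReal.ofNNReal_finsetSum, ENNReal.coe_le_coe]
  refine (nnnorm_sum_le _ _).trans (Finset.sum_le_sum fun d _ => ?_)
  rw [smul_eq_mul, nnnorm_mul]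

/-- **Substitution bound, raw form**: `‖f(a)‖_ρ ≤ ∑_d ‖f_d‖ ∏ₛ ‖aₛ‖_ρ ^ dₛ`.
[cite: GrauertRemmert1971, Kap. I §3] -/
theorem wnorm_subst_le_tsum (ρ : τ → ℝ≥0) {a : σ → MvPowerSeries τ 𝕜} (ha : HasSubst a)
    (f : MvPowerSeries σ 𝕜) :
    wnorm ρ (subst a f) ≤
      ∑' d : σ →₀ ℕ, (‖coeff d f‖₊ : ℝ≥0∞) * d.prod fun s m => wnorm ρ (a s) ^ m := by
  classical
  calc wnorm ρ (subst a f)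
      = ∑' e, (‖coeff e (subst a f)‖₊ : ℝ≥0∞) * wt ρ e := by
        unfold wnorm; simp_rw [ENNReal.coe_mul]
    _ ≤ ∑' e, (∑' d : σ →₀ ℕ,
          ((‖coeff d f‖₊ * ‖coeff e (d.prod fun s m => a s ^ m)‖₊ : ℝ≥0) : ℝ≥0∞)) * wt ρ e :=
        ENNReal.tsum_le_tsum fun e => mul_le_mul_of_nonneg_right (nnnorm_coeff_subst_le ha f e) zero_le
    _ = ∑' d : σ →₀ ℕ, (‖coeff d f‖₊ : ℝ≥0∞) * wnorm ρ (d.prod fun s m => a s ^ m) := by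
        simp_rw [← ENNReal.tsum_mul_right]
        rw [ENNReal.tsum_comm]
        refine tsum_congr fun d => ?_
        unfold wnorm
        rw [← ENNReal.tsum_mul_left]
        refine tsum_congr fun e => ?_
        push_cast
        ring
    _ ≤ ∑' d : σ →₀ ℕ, (‖coeff d f‖₊ : ℝ≥0∞) * d.prod fun s m => wnorm ρ (a s) ^ m :=
        ENNReal.tsum_le_tsum fun d => mul_le_mul_of_nonneg_left (wnorm_finsuppProd_pow_le ρ a d) zero_le

/-- If `‖aₛ‖_ρ ≤ ρ'ₛ` for all `s` then `∏ₛ ‖aₛ‖_ρ ^ dₛ ≤ ρ'^d`. [folklore] -/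
theorem finsuppProd_wnorm_le_wt {ρ : τ → ℝ≥0} {ρ' : σ → ℝ≥0} {a : σ → MvPowerSeries τ 𝕜}
    (hρ' : ∀ s, wnorm ρ (a s) ≤ ρ' s) (d : σ →₀ ℕ) :
    (d.prod fun s m => wnorm ρ (a s) ^ m) ≤ (wt ρ' d : ℝ≥0∞) := by
  rw [wt_eq_prod, Finsupp.prod, ENNReal.ofNNReal_finsetProd]
  exact Finset.prod_le_prod' fun s _ => by
    rw [ENNReal.coe_pow]; exact pow_le_pow_left₀ zero_le (hρ' s) _

/-- **Substitution bound**: if `‖aₛ‖_ρ ≤ ρ'ₛ` for all `s` then `‖f(a)‖_ρ ≤ ‖f‖_{ρ'}`.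
[cite: GrauertRemmert1971, Kap. I §3] -/
theorem wnorm_subst_le (ρ : τ → ℝ≥0) {ρ' : σ → ℝ≥0} {a : σ → MvPowerSeries τ 𝕜} (ha : HasSubst a)
    (hρ' : ∀ s, wnorm ρ (a s) ≤ ρ' s) (f : MvPowerSeries σ 𝕜) :
    wnorm ρ (subst a f) ≤ wnorm ρ' f := by
  refine (wnorm_subst_le_tsum ρ ha f).trans ?_
  unfold wnorm
  refine ENNReal.tsum_le_tsum fun d => ?_
  rw [ENNReal.coe_mul]
  exact mul_le_mul_of_nonneg_left (finsuppProd_wnorm_le_wt hρ' d) zero_le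

/-- Substitution of convergent series without constant term into a convergent series is
convergent (`σ` finite). [cite: GrauertRemmert1971, Kap. I §3] -/
theorem HasPosRadius.subst [Finite σ] {a : σ → MvPowerSeries τ 𝕜} (ha0 : ∀ s, constantCoeff (a s) = 0)
    (ha : ∀ s, HasPosRadius (a s)) {f : MvPowerSeries σ 𝕜} (hf : HasPosRadius f)
    (ρ₀ : τ → ℝ≥0) (h₀ : ∀ i, 0 < ρ₀ i) :
    HasPosRadius (subst a f) := by
  classical
  haveI := Fintype.ofFinite σ
  obtain ⟨ρ', hρ', hfin⟩ := hf
  -- common polyradius for the `a s`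
  obtain ⟨ρ₁, hρ₁, -, ha₁⟩ := HasPosRadius.exists_common_finset (Finset.univ : Finset σ)
    (f := a) (fun s _ => ha s) ρ₀ h₀
  -- shrink so that `‖a s‖ ≤ ρ' s` for every `s`
  have hsmall : ∀ s, ∃ t : ℝ≥0, 0 < t ∧ t ≤ 1 ∧ wnorm (fun i => t * ρ₁ i) (a s) < ρ' s := fun s =>
    exists_wnorm_smul_lt (ha0 s) (ha₁ s (Finset.mem_univ s)) (by exact_mod_cast hρ' s)
  choose t ht ht1 hlt using hsmall
  obtain ⟨tm, hs₀⟩ : ∃ s₀ ∈ (Finset.univ : Finset σ).image t ∪ {1},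
      ∀ x ∈ (Finset.univ : Finset σ).image t ∪ {1}, s₀ ≤ x :=
    Finset.exists_min_image _ id ⟨1, by simp⟩ |>.imp fun x hx => ⟨hx.1, hx.2⟩
  have htm_pos : 0 < tm := by
    rcases Finset.mem_union.mp hs₀.1 with h | h
    · obtain ⟨s, -, hs⟩ := Finset.mem_image.mp h
      rw [← hs]; exact ht s
    · rw [Finset.mem_singleton] at h; rw [h]; exact one_pos
  have htm_le : ∀ s, tm ≤ t s := fun s => hs₀.2 _ (Finset.mem_union_left _
    (Finset.mem_image_of_mem t (Finset.mem_univ s)))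
  refine ⟨fun i => tm * ρ₁ i, fun i => mul_pos htm_pos (hρ₁ i), ?_⟩
  refine (wnorm_subst_le _ (hasSubst_of_constantCoeff_zero ha0) (fun s => ?_) f).trans_lt hfin
  refine (wnorm_mono (fun i => ?_) (a s)).trans (hlt s).le
  exact mul_le_mul_of_nonneg_right (htm_le s) zero_le

end Subst

/-! ### 8. Evaluation on the closed polydisc -/

section Eval

/-- The value `x^α = ∏ᵢ xᵢ ^ αᵢ` of a monomial at a point. [folklore] -/
def mono (x : σ → 𝕜) (α : σ →₀ ℕ) : 𝕜 :=
  α.prod fun i k => x i ^ k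

/-- `x^0 = 1`. [folklore] -/
@[simp] theorem mono_zero_right (x : σ → 𝕜) : mono x 0 = 1 := by
  simp [mono]

/-- `x^(α+β) = x^α x^β`. [folklore] -/
theorem mono_add (x : σ → 𝕜) (α β : σ →₀ ℕ) : mono x (α + β) = mono x α * mono x β := by
  classical
  unfold mono
  exact Finsupp.prod_add_index' (fun i => pow_zero _) (fun i k l => pow_add _ _ _)

/-- `x^(single i k) = xᵢ ^ k`. [folklore] -/
@[simp] theorem mono_single (x : σ → 𝕜) (i : σ) (k : ℕ) : mono x (single i k) = x i ^ k := by
  simp [mono, Finsupp.prod_single_index]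

/-- `0^α = 0` for `α ≠ 0`. [folklore] -/
theorem mono_zero_left {α : σ →₀ ℕ} (hα : α ≠ 0) : mono (0 : σ → 𝕜) α = 0 := by
  classical
  obtain ⟨i, hi⟩ : ∃ i, α i ≠ 0 := by
    by_contra h
    push Not at h
    exact hα (Finsupp.ext h)
  rw [mono, Finsupp.prod, Finset.prod_eq_zero (i := i) (Finsupp.mem_support_iff.mpr hi)]
  simp [hi]

/-- `‖x^α‖ ≤ ρ^α` on the closed polydisc `‖xᵢ‖ ≤ ρᵢ`. [folklore] -/
theorem nnnorm_mono_le {ρ : σ → ℝ≥0} {x : σ → 𝕜} (hx : ∀ i, ‖x i‖₊ ≤ ρ i) (α : σ →₀ ℕ) :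
    ‖mono x α‖₊ ≤ wt ρ α := by
  rw [mono, Finsupp.prod, nnnorm_prod, wt_eq_prod]
  exact Finset.prod_le_prod (fun i _ => zero_le) fun i _ => by
    rw [nnnorm_pow]; exact pow_le_pow_left₀ zero_le (hx i) _

/-- The monomial functions `x ↦ x^α` are continuous. [folklore] -/
theorem continuous_mono (α : σ →₀ ℕ) : Continuous fun x : σ → 𝕜 => mono x α := by
  unfold mono Finsupp.prod
  exact continuous_finsetProd _ fun i _ => (continuous_apply i).pow _

/-- **Evaluation** of a power series at a point: `f(x) = ∑_α f_α x^α` (a genuine value when the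
series converges absolutely, e.g. on the polydisc of some finite `‖f‖_ρ`; `0` by convention
otherwise). [cite: GrauertRemmert1971, Kap. I §3] -/
def eval (f : MvPowerSeries σ 𝕜) (x : σ → 𝕜) : 𝕜 :=
  ∑' α, coeff α f * mono x α

/-- The terms of `f(x)` are dominated by those of `‖f‖_ρ` on the polydisc. [folklore] -/
theorem nnnorm_term_le {ρ : σ → ℝ≥0} {x : σ → 𝕜} (hx : ∀ i, ‖x i‖₊ ≤ ρ i) (f : MvPowerSeries σ 𝕜)
    (α : σ →₀ ℕ) : ‖coeff α f * mono x α‖₊ ≤ ‖coeff α f‖₊ * wt ρ α := by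
  rw [nnnorm_mul]
  exact mul_le_mul_of_nonneg_left (nnnorm_mono_le hx α) zero_le

/-- On the polydisc of a finite norm the defining series is absolutely summable. [folklore] -/
theorem summable_nnnorm_term {ρ : σ → ℝ≥0} {x : σ → 𝕜} (hx : ∀ i, ‖x i‖₊ ≤ ρ i)
    {f : MvPowerSeries σ 𝕜} (hf : wnorm ρ f < ⊤) :
    Summable fun α => ‖coeff α f * mono x α‖₊ := by
  rw [← ENNReal.tsum_coe_ne_top_iff_summable]
  refine (lt_of_le_of_lt (ENNReal.tsum_le_tsum fun α => ?_) hf).ne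
  exact ENNReal.coe_le_coe.mpr (nnnorm_term_le hx f α)

/-- `0(x) = 0`. [folklore] -/
@[simp] theorem eval_zero (x : σ → 𝕜) : eval (0 : MvPowerSeries σ 𝕜) x = 0 := by
  simp [eval]

/-- Evaluation of a monomial. [folklore] -/
theorem eval_monomial (α : σ →₀ ℕ) (a : 𝕜) (x : σ → 𝕜) :
    eval (monomial α a) x = a * mono x α := by
  classical
  unfold eval
  rw [tsum_eq_single α]
  · rw [coeff_monomial_same]
  · intro β hβ; rw [coeff_monomial_ne hβ, zero_mul]

/-- Evaluation of a constant. [folklore] -/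
@[simp] theorem eval_C (a : 𝕜) (x : σ → 𝕜) : eval (C a : MvPowerSeries σ 𝕜) x = a := by
  rw [← monomial_zero_eq_C_apply, eval_monomial, mono_zero_right, mul_one]

/-- `1(x) = 1`. [folklore] -/
@[simp] theorem eval_one (x : σ → 𝕜) : eval (1 : MvPowerSeries σ 𝕜) x = 1 := by
  rw [← (C : 𝕜 →+* MvPowerSeries σ 𝕜).map_one, eval_C]

/-- Evaluation of a variable. [folklore] -/
@[simp] theorem eval_X (i : σ) (x : σ → 𝕜) : eval (X i : MvPowerSeries σ 𝕜) x = x i := by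
  rw [X_def, eval_monomial, one_mul, mono_single, pow_one]

/-- **`f(0) = f₀`**: the value at the origin is the constant coefficient. [folklore] -/
theorem eval_zero_point (f : MvPowerSeries σ 𝕜) : eval f 0 = constantCoeff f := by
  classical
  unfold eval
  rw [tsum_eq_single 0]
  · simp
  · intro β hβ; rw [mono_zero_left hβ, mul_zero]

/-- `(-f)(x) = -f(x)`. [folklore] -/
theorem eval_neg (f : MvPowerSeries σ 𝕜) (x : σ → 𝕜) : eval (-f) x = -eval f x := by
  unfold eval
  rw [← tsum_neg]
  exact tsum_congr fun α => by rw [map_neg, neg_mul]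

/-- `(c • f)(x) = c f(x)`. [folklore] -/
theorem eval_smul (c : 𝕜) (f : MvPowerSeries σ 𝕜) (x : σ → 𝕜) : eval (c • f) x = c * eval f x := by
  unfold eval
  rw [← tsum_mul_left]
  exact tsum_congr fun α => by rw [map_smul, smul_eq_mul, mul_assoc]

/-- `(C c * f)(x) = c f(x)`. [folklore] -/
theorem eval_C_mul (c : 𝕜) (f : MvPowerSeries σ 𝕜) (x : σ → 𝕜) :
    eval (C c * f) x = c * eval f x := by
  rw [← smul_eq_C_mul, eval_smul]

/-- **`‖f(x)‖ ≤ ‖f‖_ρ`** on the closed polydisc `‖xᵢ‖ ≤ ρᵢ`. [cite: GrauertRemmert1971, Kap. I §3] -/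
theorem enorm_eval_le {ρ : σ → ℝ≥0} {x : σ → 𝕜} (hx : ∀ i, ‖x i‖₊ ≤ ρ i) (f : MvPowerSeries σ 𝕜) :
    (‖eval f x‖₊ : ℝ≥0∞) ≤ wnorm ρ f := by
  unfold eval wnorm
  refine le_trans ?_ (ENNReal.tsum_le_tsum fun α => ENNReal.coe_le_coe.mpr (nnnorm_term_le hx f α))
  exact enorm_tsum_le_tsum_enorm (f := fun α => coeff α f * mono x α)

/-- `‖f(x)‖ ≤ ‖f‖_ρ` over `ℝ≥0`, when the norm is finite. [folklore] -/
theorem nnnorm_eval_le {ρ : σ → ℝ≥0} {x : σ → 𝕜} (hx : ∀ i, ‖x i‖₊ ≤ ρ i) {f : MvPowerSeries σ 𝕜}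
    (hf : wnorm ρ f < ⊤) : ‖eval f x‖₊ ≤ (wnorm ρ f).toNNReal := by
  have h := enorm_eval_le hx f
  rw [← ENNReal.coe_toNNReal hf.ne] at h
  exact_mod_cast h

variable [CompleteSpace 𝕜]

/-- On the polydisc of a finite norm the defining series is summable. [folklore] -/
theorem summable_term {ρ : σ → ℝ≥0} {x : σ → 𝕜} (hx : ∀ i, ‖x i‖₊ ≤ ρ i)
    {f : MvPowerSeries σ 𝕜} (hf : wnorm ρ f < ⊤) :
    Summable fun α => coeff α f * mono x α :=
  (summable_nnnorm_term hx hf).of_nnnorm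

/-- `HasSum` form of the evaluation. [folklore] -/
theorem hasSum_eval {ρ : σ → ℝ≥0} {x : σ → 𝕜} (hx : ∀ i, ‖x i‖₊ ≤ ρ i)
    {f : MvPowerSeries σ 𝕜} (hf : wnorm ρ f < ⊤) :
    HasSum (fun α => coeff α f * mono x α) (eval f x) :=
  (summable_term hx hf).hasSum

/-- Additivity of evaluation (on the polydisc of a common finite norm). [folklore] -/
theorem eval_add {ρ : σ → ℝ≥0} {x : σ → 𝕜} (hx : ∀ i, ‖x i‖₊ ≤ ρ i) {f g : MvPowerSeries σ 𝕜}
    (hf : wnorm ρ f < ⊤) (hg : wnorm ρ g < ⊤) : eval (f + g) x = eval f x + eval g x := by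
  rw [← ((hasSum_eval hx hf).add (hasSum_eval hx hg)).tsum_eq]
  unfold eval
  exact tsum_congr fun α => by rw [map_add, add_mul]

/-- `(f - g)(x) = f(x) - g(x)`. [folklore] -/
theorem eval_sub {ρ : σ → ℝ≥0} {x : σ → 𝕜} (hx : ∀ i, ‖x i‖₊ ≤ ρ i) {f g : MvPowerSeries σ 𝕜}
    (hf : wnorm ρ f < ⊤) (hg : wnorm ρ g < ⊤) : eval (f - g) x = eval f x - eval g x := by
  rw [sub_eq_add_neg, eval_add hx hf (by rwa [wnorm_neg]), eval_neg, sub_eq_add_neg]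

/-- Finite additivity. [folklore] -/
theorem eval_finset_sum {ι : Type*} {ρ : σ → ℝ≥0} {x : σ → 𝕜} (hx : ∀ i, ‖x i‖₊ ≤ ρ i)
    (s : Finset ι) {f : ι → MvPowerSeries σ 𝕜} (hf : ∀ i ∈ s, wnorm ρ (f i) < ⊤) :
    eval (∑ i ∈ s, f i) x = ∑ i ∈ s, eval (f i) x := by
  classical
  induction s using Finset.induction_on with
  | empty => simp
  | insert a s ha ih =>
    have hs : wnorm ρ (∑ i ∈ s, f i) < ⊤ :=
      (wnorm_sum_le ρ s f).trans_lt (ENNReal.sum_lt_top.mpr fun i hi =>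
        hf i (Finset.mem_insert_of_mem hi))
    rw [Finset.sum_insert ha, Finset.sum_insert ha,
      eval_add hx (hf a (Finset.mem_insert_self a s)) hs,
      ih fun i hi => hf i (Finset.mem_insert_of_mem hi)]

/-- **Multiplicativity of evaluation** (Cauchy product of two absolutely convergent series).
[cite: GrauertRemmert1971, Kap. I §3] -/
theorem eval_mul {ρ : σ → ℝ≥0} {x : σ → 𝕜} (hx : ∀ i, ‖x i‖₊ ≤ ρ i) {f g : MvPowerSeries σ 𝕜}
    (hf : wnorm ρ f < ⊤) (hg : wnorm ρ g < ⊤) : eval (f * g) x = eval f x * eval g x := by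
  classical
  have hF' : Summable fun α => ‖coeff α f * mono x α‖ :=
    NNReal.summable_coe.2 (summable_nnnorm_term hx hf)
  have hG' : Summable fun α => ‖coeff α g * mono x α‖ :=
    NNReal.summable_coe.2 (summable_nnnorm_term hx hg)
  have hFG : Summable fun p : (σ →₀ ℕ) × (σ →₀ ℕ) =>
      (coeff p.1 f * mono x p.1) * (coeff p.2 g * mono x p.2) :=
    summable_mul_of_summable_norm (f := fun α => coeff α f * mono x α)
      (g := fun α => coeff α g * mono x α) hF' hG'
  have hprod := (summable_term hx hf).tsum_mul_tsum_eq_tsum_sum_antidiagonal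
    (summable_term hx hg) hFG
  simp only [eval]
  rw [hprod]
  refine tsum_congr fun n => ?_
  rw [coeff_mul, Finset.sum_mul]
  refine Finset.sum_congr rfl fun kl hkl => ?_
  obtain rfl : kl.1 + kl.2 = n := Finset.mem_antidiagonal.mp hkl
  rw [mono_add]
  ring

/-- Finite multiplicativity. [folklore] -/
theorem eval_finset_prod {ι : Type*} {ρ : σ → ℝ≥0} {x : σ → 𝕜} (hx : ∀ i, ‖x i‖₊ ≤ ρ i)
    (s : Finset ι) {f : ι → MvPowerSeries σ 𝕜} (hf : ∀ i ∈ s, wnorm ρ (f i) < ⊤) :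
    eval (∏ i ∈ s, f i) x = ∏ i ∈ s, eval (f i) x := by
  classical
  induction s using Finset.induction_on with
  | empty => simp
  | insert a s ha ih =>
    have hs : wnorm ρ (∏ i ∈ s, f i) < ⊤ :=
      (wnorm_prod_le ρ s f).trans_lt (ENNReal.prod_lt_top fun i hi =>
        hf i (Finset.mem_insert_of_mem hi))
    rw [Finset.prod_insert ha, Finset.prod_insert ha,
      eval_mul hx (hf a (Finset.mem_insert_self a s)) hs,
      ih fun i hi => hf i (Finset.mem_insert_of_mem hi)]

/-- `(f ^ k)(x) = f(x) ^ k`. [folklore] -/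
theorem eval_pow {ρ : σ → ℝ≥0} {x : σ → 𝕜} (hx : ∀ i, ‖x i‖₊ ≤ ρ i) {f : MvPowerSeries σ 𝕜}
    (hf : wnorm ρ f < ⊤) (k : ℕ) : eval (f ^ k) x = eval f x ^ k := by
  induction k with
  | zero => simp
  | succ k ih =>
    have hk : wnorm ρ (f ^ k) < ⊤ := (wnorm_pow_le ρ f k).trans_lt (ENNReal.pow_lt_top hf)
    rw [pow_succ, pow_succ, eval_mul hx hk hf, ih]

/-- Evaluation of a multi-power `∏ₛ (a s) ^ (d s)`. [folklore] -/
theorem eval_finsuppProd_pow {τ : Type*} {ρ : σ → ℝ≥0} {x : σ → 𝕜} (hx : ∀ i, ‖x i‖₊ ≤ ρ i)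
    {a : τ → MvPowerSeries σ 𝕜} (ha : ∀ s, wnorm ρ (a s) < ⊤) (d : τ →₀ ℕ) :
    eval (d.prod fun s m => a s ^ m) x = mono (fun s => eval (a s) x) d := by
  unfold Finsupp.prod mono
  rw [eval_finset_prod hx _ fun s _ => (wnorm_pow_le ρ _ _).trans_lt (ENNReal.pow_lt_top (ha s))]
  exact Finset.prod_congr rfl fun s _ => eval_pow hx (ha s) _

/-- **Continuity of `x ↦ f(x)` on the closed polydisc** of a finite norm (normal convergence).
[cite: GrauertRemmert1971, Kap. I §3] -/
theorem continuousOn_eval {ρ : σ → ℝ≥0} {f : MvPowerSeries σ 𝕜} (hf : wnorm ρ f < ⊤) :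
    ContinuousOn (eval f) {x | ∀ i, ‖x i‖₊ ≤ ρ i} := by
  have hu : Summable fun α => ((‖coeff α f‖₊ * wt ρ α : ℝ≥0) : ℝ) := by
    rw [NNReal.summable_coe, ← ENNReal.tsum_coe_ne_top_iff_summable]
    exact hf.ne
  refine continuousOn_tsum (fun α => ((continuous_mono α).const_mul _).continuousOn) hu ?_
  intro α x hx
  have h := nnnorm_term_le hx f α
  exact_mod_cast h

end Eval

/-! ### 9. Evaluation commutes with substitution -/

section EvalSubst

variable [CompleteSpace 𝕜]

/-- **`f(a)(x) = f(a(x))`**: evaluation commutes with substitution, on the polydisc where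
`‖aₛ‖_ρ ≤ ρ'ₛ` and `‖f‖_{ρ'} < ∞` (absolutely convergent double series).
[cite: GrauertRemmert1971, Kap. I §3] -/
theorem eval_subst {τ : Type*} {a : σ → MvPowerSeries τ 𝕜} (ha : HasSubst a)
    {ρ : τ → ℝ≥0} {ρ' : σ → ℝ≥0} (hρ' : ∀ s, wnorm ρ (a s) ≤ ρ' s)
    {f : MvPowerSeries σ 𝕜} (hf : wnorm ρ' f < ⊤) {x : τ → 𝕜} (hx : ∀ i, ‖x i‖₊ ≤ ρ i) :
    eval (subst a f) x = eval f (fun s => eval (a s) x) := by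
  classical
  have ha' : ∀ s, wnorm ρ (a s) < ⊤ := fun s => (hρ' s).trans_lt ENNReal.coe_lt_top
  set P : (σ →₀ ℕ) → MvPowerSeries τ 𝕜 := fun d => d.prod fun s m => a s ^ m with hP
  set H : (σ →₀ ℕ) → (τ →₀ ℕ) → 𝕜 := fun d e => coeff d f * (coeff e (P d) * mono x e) with hH
  -- absolute summability of the double family
  have hHsum : Summable (Function.uncurry H) := by
    refine Summable.of_nnnorm (ENNReal.tsum_coe_ne_top_iff_summable.mp (lt_of_le_of_lt ?_ hf).ne)
    rw [ENNReal.tsum_prod']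
    unfold wnorm
    refine ENNReal.tsum_le_tsum fun d => ?_
    calc ∑' e, (‖Function.uncurry H (d, e)‖₊ : ℝ≥0∞)
        ≤ ∑' e, (‖coeff d f‖₊ : ℝ≥0∞) * ((‖coeff e (P d)‖₊ * wt ρ e : ℝ≥0) : ℝ≥0∞) := by
          refine ENNReal.tsum_le_tsum fun e => ?_
          simp only [Function.uncurry_apply_pair, hH]
          rw [← ENNReal.coe_mul, ENNReal.coe_le_coe, nnnorm_mul]
          exact mul_le_mul_of_nonneg_left (nnnorm_term_le hx (P d) e) zero_le
      _ = (‖coeff d f‖₊ : ℝ≥0∞) * wnorm ρ (P d) := by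
          rw [ENNReal.tsum_mul_left]; rfl
      _ ≤ (‖coeff d f‖₊ : ℝ≥0∞) * wt ρ' d := by
          refine mul_le_mul_of_nonneg_left ?_ zero_le
          exact (wnorm_finsuppProd_pow_le ρ a d).trans (finsuppProd_wnorm_le_wt hρ' d)
      _ = ((‖coeff d f‖₊ * wt ρ' d : ℝ≥0) : ℝ≥0∞) := by rw [ENNReal.coe_mul]
  -- the inner sums of the left-hand side
  have hcoeff : ∀ e, coeff e (subst a f) * mono x e = ∑' d, H d e := by
    intro e
    rw [coeff_subst ha f e, ← tsum_eq_finsum (L := SummationFilter.unconditional _)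
      (coeff_subst_finite ha f e), ← tsum_mul_right]
    refine tsum_congr fun d => ?_
    simp only [hH, hP, smul_eq_mul, mul_assoc]
  calc eval (subst a f) x = ∑' e, ∑' d, H d e := tsum_congr hcoeff
    _ = ∑' d, ∑' e, H d e := hHsum.tsum_comm
    _ = ∑' d, coeff d f * eval (P d) x := by
        refine tsum_congr fun d => ?_
        simp only [hH]
        rw [tsum_mul_left]
        rfl
    _ = eval f (fun s => eval (a s) x) := by
        conv_rhs => rw [eval]
        refine tsum_congr fun d => ?_
        change coeff d f * eval (d.prod fun s m => a s ^ m) x = _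
        rw [eval_finsuppProd_pow hx ha' d]

end EvalSubst

end Literature.RingTheory.MvPowerSeries
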